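import Summits.Ventures.HSemireg.WedgeHankelRecurrenceBezoutianCauchyIndex
import Summits.Ventures.HSemireg.WedgeHankelRecurrenceBezoutianResultant
import Summits.Ventures.HSemireg.WedgeHankelRecurrenceCongruence

/-!
# Venture HSemireg — HERMITE–KRONECKER–HURWITZ IN THE HANKEL DRESS: for `P` monic real of degree `e + 1 ≤ t + 1` and ANY `Q`, **`Sign H_t(Q/P) = Ind(Q/P)`** (the signature of the Hankel form
# of the moments of `Q/P` is the Cauchy index — BPR Thm. 9.4 (2) read through Prop. 9.20, multiple roots allowed), hence the INERTIA IN CLOSED FORM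
# **`2·sigPos H_t(Q/P) = deg(P/gcd(P,Q)) + Ind(Q/P)`**, **`2·sigNeg H_t(Q/P) = deg(P/gcd(P,Q)) − Ind(Q/P)`**, `|Ind(Q/P)| ≤ deg(P/gcd)`; and the same closed form for the Bezoutian `B(Q, P)` of ANY
# real `P` of degree `t + 1`

HONEST FRAMING. Part of the Lean index of the computation cell `pub-hsemireg` (seat p10 gen 36, Sunday typer «UNIFORM-IN-n»).
LINEAR ALGEBRA OF HANKEL ∕ BEZOUTIAN MATRICES AND REAL POLYNOMIALS ONLY (Mathlib's `sigPos` ∕ `sigNeg`, `Matrix.rank`; PROVED Literature `Algebra/Polynomial/CauchyIndex` (`cauchyIndex`) IMPORTED through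
N150): no variety, no cohomology theory, no sheaf, no Ext group and no semiregularity map is constructed here; nothing here says that HC / HC_CM / HC_AV holds; no Literature fact (unproved `Prop`)
is declared or used.  Custodian versions as in `WedgeHankelSiegelIdeal` (1/3).
SOURCE OF THE ARGUMENT (cited; held text read, `book:basu2006-algorithms-real-algebraic-geometry` pp. 326–335): BPR **Theorem 9.4** «`Rank(Bez(P,Q)) = deg(P) − deg(gcd(P,Q))`, `Sign(Bez(P,Q)) =
Ind(Q/P)`» with **Proposition 9.20** ∕ **Remark 9.21** (the Bezoutian is the Hankel form `Han(s̄)` of the moments of `Q/P` in the Horner basis); F. R. Gantmacher, *The Theory of Matrices* II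
(1959) Ch. XV §9 Thm. 9 (Hermite–Hurwitz–Kronecker: «the index of `R(x)` equals the signature of the Hankel form `S(s_0, …, s_{2n−2})`») for the classical wording.  Here: N150 proves the
Bezoutian statement for every real `P ≠ 0`; N141 `sigPos ∕ sigNeg B(Q mod P, P) = sigPos ∕ sigNeg H_e(Q/P)` (monic `P` of degree `e + 1`) and N136's SIZE INDEPENDENCE move it to `H_t(Q/P)`,
`t ≥ e`; N142's `rank H_t(Q/P) = deg(P/gcd)` at every size and N132 `rank = sigPos + sigNeg` give the closed forms.
DEDUP DISCLOSURE (`rg` of the whole tree + Mathlib, 2026-09-01): N148 (`…SignatureCauchyIndex`) has `Sign H_t(a/P) = cauchyIndex P a` for SEPARABLE monic `P` only (Hermite–Hurwitz with simple poles,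
`sigPos_sub_sigNeg_hankelSq_dualSeq_eq_cauchyIndex`); N150 has the BEZOUTIAN statement `Sign B(Q, P) = Ind(Q/P)` and says in its caveats that the Hankel reading is not restated there; N129 ∕ N133
have the Hermite numerators `Q·P′`; NO file gives `Sign H_t(Q/P) = Ind(Q/P)` for arbitrary monic `P` and `Q`, nor `sigPos` ∕ `sigNeg` of `H_t(Q/P)` or `B(Q, P)` in closed form through the Cauchy
index — that is this file.  9 names: 0 hits tree-wide.

WHAT IS IN THE TREE (or staged ahead).  N150 **`sign_bezoutian_eq_cauchyIndex`** (`P ≠ 0`, `Q = 0 ∨ deg Q < deg P`), **`sign_bezoutian_eq_cauchyIndex_mod`** (any `Q`, numerator `Q % P`); N141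
`sigPos_sigNeg_bezoutian_modByMonic_eq` (`sigPos ∕ sigNeg B(a mod m, m) = sigPos ∕ sigNeg H_e(a/m)`); N136 `sigPos_ ∕ sigNeg_hankelSq_dualSeq_eq_of_natDegree_le` (size independence); N142
`rank_hankelSq_dualSeq_eq_natDegree_div_gcd_of_le`; N132 `rank_hankelSq_eq_sigPos_add_sigNeg`, `rank_eq_sigPos_add_sigNeg`; N151 `rank_bezoutian_add_natDegree_gcd_of_natDegree_eq`; N101
`natDegree_div_gcd_add`; Literature `Bezoutian.bezoutian_isSymm`; Mathlib `Polynomial.modByMonic_eq_mod`.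
THIS FILE (namespace `Summit.Ventures.HSemireg.Wedge.HankelOuter` continued; CHAINED on N150 + N151 + N142; 0 definitions):
* §769 THE HANKEL SIGNATURE IS THE CAUCHY INDEX: **`sigPos_sub_sigNeg_hankelSq_dualSeq_eq_cauchyIndex_of_monic`** (`P` monic real of degree `e + 1 ≤ t + 1`, ANY `Q`, real roots of `P` in
  `(lo, hi)`: `sigPos H_t(Q/P) − sigNeg H_t(Q/P) = cauchyIndex P Q lo hi`).
* §770 THE INERTIA IN CLOSED FORM (Hankel): `sigPos_add_sigNeg_hankelSq_dualSeq_eq_natDegree_div_gcd` (any linearly ordered field: `sigPos + sigNeg = deg(P/gcd(P,Q))` at every size `t ≥ e`),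
  **`two_mul_sigPos_hankelSq_dualSeq_eq`** (`2·sigPos H_t(Q/P) = deg(P/gcd(P,Q)) + Ind(Q/P)`), **`two_mul_sigNeg_hankelSq_dualSeq_eq`** (`2·sigNeg = deg(P/gcd) − Ind`),
  `abs_cauchyIndex_le_natDegree_div_gcd` (`|Ind(Q/P)| ≤ deg(P/gcd(P,Q))`, `P` monic), `cauchyIndex_add_natDegree_div_gcd_even` (`Ind(Q/P) ≡ deg(P/gcd) (mod 2)`).
* §771 THE INERTIA IN CLOSED FORM (Bezoutian, ANY real `P` of degree `t + 1`, `Q = 0 ∨ deg Q < deg P`): `sigPos_add_sigNeg_bezoutian_add_natDegree_gcd` (`sigPos + sigNeg + deg gcd(P,Q) = t + 1`, any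
  ordered field, `deg Q ≤ t + 1`), **`two_mul_sigPos_bezoutian_add_natDegree_gcd_eq`** (`2·sigPos B(Q,P) + deg gcd(P,Q) = (t + 1) + Ind(Q/P)`), **`two_mul_sigNeg_bezoutian_add_natDegree_gcd_eq`**
  (`2·sigNeg B(Q,P) + deg gcd(P,Q) = (t + 1) − Ind(Q/P)`).
CAVEATS.  `ℝ` only for everything involving `cauchyIndex` (the tree's Cauchy index is real); the Hankel side needs `P` MONIC (the moments `dualSeq` are defined through `%ₘ`) — for a general
denominator normalise first (N151 `exists_eq_C_mul_monic`; `Ind` is insensitive to `Q ↦ c⁻¹Q` up to the sign of `c`, not typed here); §771 keeps N150's hypothesis `Q = 0 ∨ deg Q < deg P` (reduce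
`Q` modulo `P` otherwise: `B(Q − cP, P) = B(Q, P)`).
Nothing Ext-side.  New names only.
-/

open Module Polynomial
open scoped Matrix Polynomial

namespace Summit.Ventures.HSemireg.Wedge.HankelOuter

open Summit.Ventures.HSemireg.Wedge Summit.Ventures.HSemireg.Wedge.Hankel
open Literature.LinearAlgebra.Matrix.Bezoutian (bezoutian bezoutian_isSymm)
open Literature.Algebra.Polynomial (cauchyIndex)

variable (K : Type*) [Field K]

/-! ## §769. The signature of the Hankel form of `Q/P` is the Cauchy index of `Q/P` -/

/-- **HERMITE–KRONECKER–HURWITZ ∕ BPR THM. 9.4 (2) IN THE HANKEL DRESS: `Sign H_t(Q/P) = Ind(Q/P)`** — for `P` monic real of degree `e + 1 ≤ t + 1`, ANY `Q`, and any window `(lo, hi)`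
containing the real roots of `P`: `sigPos H_t(Q/P) − sigNeg H_t(Q/P) = cauchyIndex P Q lo hi` (`H_t(Q/P) = (dualSeq P Q (i + j))_{i,j ≤ t}`; size independence N136, `B(Q mod P, P) ≅ H_e(Q/P)`
N141, and N150 for the Bezoutian). [this file, §769] -/
theorem sigPos_sub_sigNeg_hankelSq_dualSeq_eq_cauchyIndex_of_monic {e t : ℕ} {P : ℝ[X]} (hP : P.Monic) (hPd : P.natDegree = e + 1) (ht : e + 1 ≤ t + 1) (Q : ℝ[X]) {lo hi : ℝ}
    (hroots : ∀ x ∈ P.roots, lo < x ∧ x < hi) :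
    (sigPos (hankelSq ℝ t (dualSeq ℝ P Q)).toQuadraticForm' : ℤ) - sigNeg (hankelSq ℝ t (dualSeq ℝ P Q)).toQuadraticForm' = cauchyIndex P Q lo hi := by
  obtain ⟨h1, h2⟩ := sigPos_sigNeg_bezoutian_modByMonic_eq hP hPd Q
  have h := sign_bezoutian_eq_cauchyIndex_mod P Q hP.ne_zero hroots
  rw [← modByMonic_eq_mod Q hP, hPd, h1, h2] at h
  rw [sigPos_hankelSq_dualSeq_eq_of_natDegree_le hP hPd ht Q, sigNeg_hankelSq_dualSeq_eq_of_natDegree_le hP hPd ht Q]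
  exact h

/-! ## §770. The inertia of `H_t(Q/P)` in closed form -/

section Ordered

variable {K} [LinearOrder K] [IsStrictOrderedRing K]

/-- **`sigPos H_t(Q/P) + sigNeg H_t(Q/P) = deg(P / gcd(P, Q))`** for `P` monic of degree `e + 1 ≤ t + 1` over any linearly ordered field (N132 `rank = sigPos + sigNeg`, N142's rank of
`H_t(Q/P)` at every admissible size). [this file, §770] -/
theorem sigPos_add_sigNeg_hankelSq_dualSeq_eq_natDegree_div_gcd [DecidableEq K] {e t : ℕ} {P : K[X]} (hP : P.Monic) (hPd : P.natDegree = e + 1) (ht : e + 1 ≤ t + 1) (Q : K[X]) :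
    sigPos (hankelSq K t (dualSeq K P Q)).toQuadraticForm' + sigNeg (hankelSq K t (dualSeq K P Q)).toQuadraticForm' = (P / EuclideanDomain.gcd P Q).natDegree := by
  rw [← rank_hankelSq_eq_sigPos_add_sigNeg, rank_hankelSq_dualSeq_eq_natDegree_div_gcd_of_le K hP hPd ht]

end Ordered

/-- **`2·sigPos H_t(Q/P) = deg(P/gcd(P, Q)) + Ind(Q/P)`** (`P` monic real of degree `e + 1 ≤ t + 1`, any `Q`, real roots of `P` in `(lo, hi)`). [this file, §770] -/
theorem two_mul_sigPos_hankelSq_dualSeq_eq {e t : ℕ} {P : ℝ[X]} (hP : P.Monic) (hPd : P.natDegree = e + 1) (ht : e + 1 ≤ t + 1) (Q : ℝ[X]) {lo hi : ℝ}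
    (hroots : ∀ x ∈ P.roots, lo < x ∧ x < hi) :
    2 * (sigPos (hankelSq ℝ t (dualSeq ℝ P Q)).toQuadraticForm' : ℤ) = (P / EuclideanDomain.gcd P Q).natDegree + cauchyIndex P Q lo hi := by
  have h1 := sigPos_sub_sigNeg_hankelSq_dualSeq_eq_cauchyIndex_of_monic hP hPd ht Q hroots
  have h2 := sigPos_add_sigNeg_hankelSq_dualSeq_eq_natDegree_div_gcd hP hPd ht Q
  omega

/-- **`2·sigNeg H_t(Q/P) = deg(P/gcd(P, Q)) − Ind(Q/P)`.** [this file, §770] -/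
theorem two_mul_sigNeg_hankelSq_dualSeq_eq {e t : ℕ} {P : ℝ[X]} (hP : P.Monic) (hPd : P.natDegree = e + 1) (ht : e + 1 ≤ t + 1) (Q : ℝ[X]) {lo hi : ℝ}
    (hroots : ∀ x ∈ P.roots, lo < x ∧ x < hi) :
    2 * (sigNeg (hankelSq ℝ t (dualSeq ℝ P Q)).toQuadraticForm' : ℤ) = (P / EuclideanDomain.gcd P Q).natDegree - cauchyIndex P Q lo hi := by
  have h1 := sigPos_sub_sigNeg_hankelSq_dualSeq_eq_cauchyIndex_of_monic hP hPd ht Q hroots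
  have h2 := sigPos_add_sigNeg_hankelSq_dualSeq_eq_natDegree_div_gcd hP hPd ht Q
  omega

/-- **`|Ind(Q/P)| ≤ deg(P/gcd(P, Q))`** for `P` monic real of positive degree and any `Q` (both `sigPos` and `sigNeg` of `H(Q/P)` are non-negative). [this file, §770] -/
theorem abs_cauchyIndex_le_natDegree_div_gcd {e : ℕ} {P : ℝ[X]} (hP : P.Monic) (hPd : P.natDegree = e + 1) (Q : ℝ[X]) {lo hi : ℝ} (hroots : ∀ x ∈ P.roots, lo < x ∧ x < hi) :
    |cauchyIndex P Q lo hi| ≤ (P / EuclideanDomain.gcd P Q).natDegree := by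
  have h1 := two_mul_sigPos_hankelSq_dualSeq_eq hP hPd le_rfl Q hroots
  have h2 := two_mul_sigNeg_hankelSq_dualSeq_eq hP hPd le_rfl Q hroots
  rw [abs_le]
  constructor <;> omega

/-- **`Ind(Q/P) + deg(P/gcd(P, Q))` is even** (`P` monic real of positive degree, any `Q`). [this file, §770] -/
theorem cauchyIndex_add_natDegree_div_gcd_even {e : ℕ} {P : ℝ[X]} (hP : P.Monic) (hPd : P.natDegree = e + 1) (Q : ℝ[X]) {lo hi : ℝ} (hroots : ∀ x ∈ P.roots, lo < x ∧ x < hi) :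
    Even (cauchyIndex P Q lo hi + (P / EuclideanDomain.gcd P Q).natDegree) := by
  have h1 := two_mul_sigPos_hankelSq_dualSeq_eq hP hPd le_rfl Q hroots
  exact ⟨(sigPos (hankelSq ℝ e (dualSeq ℝ P Q)).toQuadraticForm' : ℤ), by omega⟩

/-! ## §771. The inertia of the Bezoutian `B(Q, P)` in closed form, any real `P` of degree `t + 1` -/

section Ordered

variable {K} [LinearOrder K] [IsStrictOrderedRing K]

/-- **`sigPos B(Q, P) + sigNeg B(Q, P) + deg gcd(P, Q) = t + 1`** for `P` of degree `t + 1` (any leading coefficient), `deg Q ≤ t + 1`, over any linearly ordered field (N132 `rank = sigPos +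
sigNeg` for the symmetric `B(Q, P)`, N151's rank law). [this file, §771] -/
theorem sigPos_add_sigNeg_bezoutian_add_natDegree_gcd [DecidableEq K] {t : ℕ} {P : K[X]} (hPd : P.natDegree = t + 1) {Q : K[X]} (hQ : Q.natDegree ≤ t + 1) :
    sigPos (bezoutian (t + 1) Q P).toQuadraticForm' + sigNeg (bezoutian (t + 1) Q P).toQuadraticForm' + (EuclideanDomain.gcd P Q).natDegree = t + 1 := by
  rw [← rank_eq_sigPos_add_sigNeg (bezoutian_isSymm (t + 1) Q P)]
  exact rank_bezoutian_add_natDegree_gcd_of_natDegree_eq K hPd hQ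

end Ordered

/-- **`2·sigPos B(Q, P) + deg gcd(P, Q) = (t + 1) + Ind(Q/P)`** for EVERY real `P` of degree `t + 1`, `Q = 0 ∨ deg Q < deg P`, real roots of `P` in `(lo, hi)` (N150's signature and §771's
rank). [this file, §771] -/
theorem two_mul_sigPos_bezoutian_add_natDegree_gcd_eq {t : ℕ} {P : ℝ[X]} (hPd : P.natDegree = t + 1) {Q : ℝ[X]} (hPQ : Q = 0 ∨ Q.natDegree < P.natDegree) {lo hi : ℝ}
    (hroots : ∀ x ∈ P.roots, lo < x ∧ x < hi) :
    2 * (sigPos (bezoutian (t + 1) Q P).toQuadraticForm' : ℤ) + (EuclideanDomain.gcd P Q).natDegree = (t + 1 : ℤ) + cauchyIndex P Q lo hi := by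
  have hP : P ≠ 0 := fun h => by rw [h, natDegree_zero] at hPd; omega
  have hQ : Q.natDegree ≤ t + 1 := by
    rcases hPQ with h | h
    · rw [h, natDegree_zero]; exact Nat.zero_le _
    · exact (h.trans_eq hPd).le
  have h1 := sign_bezoutian_eq_cauchyIndex P Q hP hPQ hroots
  rw [hPd] at h1
  have h2 := sigPos_add_sigNeg_bezoutian_add_natDegree_gcd (K := ℝ) hPd hQ
  omega

/-- **`2·sigNeg B(Q, P) + deg gcd(P, Q) = (t + 1) − Ind(Q/P)`** (every real `P` of degree `t + 1`, `Q = 0 ∨ deg Q < deg P`). [this file, §771] -/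
theorem two_mul_sigNeg_bezoutian_add_natDegree_gcd_eq {t : ℕ} {P : ℝ[X]} (hPd : P.natDegree = t + 1) {Q : ℝ[X]} (hPQ : Q = 0 ∨ Q.natDegree < P.natDegree) {lo hi : ℝ}
    (hroots : ∀ x ∈ P.roots, lo < x ∧ x < hi) :
    2 * (sigNeg (bezoutian (t + 1) Q P).toQuadraticForm' : ℤ) + (EuclideanDomain.gcd P Q).natDegree = (t + 1 : ℤ) - cauchyIndex P Q lo hi := by
  have hP : P ≠ 0 := fun h => by rw [h, natDegree_zero] at hPd; omega
  have hQ : Q.natDegree ≤ t + 1 := by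
    rcases hPQ with h | h
    · rw [h, natDegree_zero]; exact Nat.zero_le _
    · exact (h.trans_eq hPd).le
  have h1 := sign_bezoutian_eq_cauchyIndex P Q hP hPQ hroots
  rw [hPd] at h1
  have h2 := sigPos_add_sigNeg_bezoutian_add_natDegree_gcd (K := ℝ) hPd hQ
  omega

end Summit.Ventures.HSemireg.Wedge.HankelOuter
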